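import Summits.QuantumFields.YangMills.Theorems.ComplexCouplingChannelHarmonicMeasureEngineTorusLegPrelims

/-!
# `p log ‖Z‖ − q log ‖Z'‖` is locally the real part of a holomorphic function

Stub `stub_localRePart` of line `Sketch` (transport) for crux `FreeEnergyWindowChannel`
(item `stmt-QuantumFields-18842`, route `ComplexCouplingChannel` of `QuantumFields/YangMills`).
Pure one-complex-variable analysis.

For `Z, Z'` holomorphic and zero-free on `D` and real `p, q`, on every disc `ball c R ⊆ D` the real function
`p log ‖Z‖ − q log ‖Z'‖` is the real part of a holomorphic function.  Mathlib has no harmonic conjugates, so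
we use local holomorphic logarithms: `W w := Z (c + w) / Z c` is holomorphic and zero-free on `ball 0 R` with
`W 0 = 1`, hence `W = exp ∘ g` for a holomorphic `g` (tree lemma
`ComplexCouplingChannel.exists_differentiableOn_exp_eq`), and `Re g w = log ‖W w‖ = log ‖Z (c + w)‖ − log ‖Z c‖`.
Shifting back and adding the real constant `log ‖Z c‖` gives a holomorphic function on `ball c R` with real
part `log ‖Z‖`; a real-linear combination of two such functions finishes.
-/

open Complex Metric Set Filter Topology

open Summit.QuantumFields.YangMills.Theorems.ComplexCouplingChannel

namespace Summit.QuantumFields.YangMills.Theorems.FreeEnergyWindowChannel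

/-- On a disc where `Z` is holomorphic and zero-free, `log ‖Z‖` is the real part of a holomorphic function
(local holomorphic logarithm of `Z (c + ·) / Z c` plus the real constant `log ‖Z c‖`). -/
theorem exists_differentiableOn_re_eq_log_norm {Z : ℂ → ℂ} {c : ℂ} {R : ℝ} (hR : 0 < R)
    (hZ : DifferentiableOn ℂ Z (ball c R)) (hZ0 : ∀ z ∈ ball c R, Z z ≠ 0) :
    ∃ g : ℂ → ℂ, DifferentiableOn ℂ g (ball c R) ∧ ∀ z ∈ ball c R, (g z).re = Real.log ‖Z z‖ := by
  have hc0 : Z c ≠ 0 := hZ0 c (mem_ball_self hR)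
  -- normalise at the centre and shift the disc to the origin
  set W : ℂ → ℂ := fun w => Z (c + w) / Z c with hW
  have hmaps : MapsTo (fun w : ℂ => c + w) (ball 0 R) (ball c R) := by
    intro w hw
    rw [mem_ball_zero_iff] at hw
    rwa [mem_ball, dist_eq_norm, add_sub_cancel_left]
  have hWd : DifferentiableOn ℂ W (ball 0 R) :=
    (hZ.comp ((differentiableOn_const c).add differentiableOn_id) hmaps).div_const _
  have hW0 : ∀ w ∈ ball 0 R, W w ≠ 0 := fun w hw => div_ne_zero (hZ0 _ (hmaps hw)) hc0
  have hW1 : W 0 = 1 := by simp [hW, hc0]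
  obtain ⟨g, hgd, -, hg⟩ := exists_differentiableOn_exp_eq hR hWd hW0 hW1
  have hmaps' : MapsTo (fun z : ℂ => z - c) (ball c R) (ball 0 R) := by
    intro z hz
    rwa [mem_ball_zero_iff, ← dist_eq_norm]
  refine ⟨fun z => g (z - c) + (Real.log ‖Z c‖ : ℂ), ?_, ?_⟩
  · exact (hgd.comp (differentiableOn_id.sub_const c) hmaps').add_const _
  · intro z hz
    have hzc : z - c ∈ ball (0 : ℂ) R := hmaps' hz
    -- `‖exp (g (z - c))‖ = exp (Re g (z - c)) = ‖W (z - c)‖ = ‖Z z‖ / ‖Z c‖`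
    have h1 : Real.exp (g (z - c)).re = ‖Z z‖ / ‖Z c‖ := by
      rw [← norm_exp, hg _ hzc, hW]
      simp only [add_sub_cancel, norm_div]
    have h2 : (g (z - c)).re = Real.log ‖Z z‖ - Real.log ‖Z c‖ := by
      rw [← Real.log_exp (g (z - c)).re, h1,
        Real.log_div (norm_ne_zero_iff.2 (hZ0 z hz)) (norm_ne_zero_iff.2 hc0)]
    simp only [add_re, ofReal_re, h2]
    ring

/-- STUB S3 of line `Sketch` (transport).  For `Z, Z'` holomorphic and zero-free on `D` and real `p, q`, the
function `p log ‖Z‖ − q log ‖Z'‖` is, on every disc `ball c R ⊆ D`, the real part of a holomorphic function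
(real-linear combination of two instances of `exists_differentiableOn_re_eq_log_norm`).  The hypothesis
`IsOpen D` is part of the registered signature but not needed. -/
theorem stub_localRePart :
    ∀ (Z Z' : ℂ → ℂ) (p q : ℝ) (D : Set ℂ), IsOpen D → DifferentiableOn ℂ Z D → DifferentiableOn ℂ Z' D →
      (∀ z ∈ D, Z z ≠ 0) → (∀ z ∈ D, Z' z ≠ 0) →
      ∀ (c : ℂ) (R : ℝ), 0 < R → Metric.ball c R ⊆ D →
        ∃ φ : ℂ → ℂ, DifferentiableOn ℂ φ (Metric.ball c R) ∧
          ∀ z ∈ Metric.ball c R, (φ z).re = p * Real.log ‖Z z‖ - q * Real.log ‖Z' z‖ := by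
  intro Z Z' p q D _ hZ hZ' hZ0 hZ0' c R hR hsub
  obtain ⟨g, hgd, hg⟩ :=
    exists_differentiableOn_re_eq_log_norm hR (hZ.mono hsub) fun z hz => hZ0 z (hsub hz)
  obtain ⟨g', hgd', hg'⟩ :=
    exists_differentiableOn_re_eq_log_norm hR (hZ'.mono hsub) fun z hz => hZ0' z (hsub hz)
  refine ⟨fun z => (p : ℂ) * g z - (q : ℂ) * g' z,
    ((differentiableOn_const _).mul hgd).sub ((differentiableOn_const _).mul hgd'), ?_⟩
  intro z hz
  simp only [sub_re, mul_re, ofReal_re, ofReal_im, zero_mul, sub_zero, hg z hz, hg' z hz]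

end Summit.QuantumFields.YangMills.Theorems.FreeEnergyWindowChannel
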